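import Literature.AnabelianGeometry.SemiGraphs.TemperedAnabelianThm68ivTransportLemmas2

/-!
# [SemiAnbd] Thm. 6.8 (iv) re-cut: TRANSPORT of tripod-Belyi witnesses along `α` (row T68iv-L06′, PROVED)

Mochizuki, *Semi-graphs of anabelioids* [SemiAnbd], §6 Thm. 6.8 (iv), ms. p. 75; printed mechanism = [GalSect]
Cor. 2.8 proof, ms. p. 11: «Thus, by transporting `φ`, `β_Z` via the equivalences of Theorem 2.3, (i), and applying
Theorem 1.3, (ii), (iii) [as in the proof of Corollary 2.5], we conclude …»; Rmk. 2.8.1 p. 12 (arrows of OF-type are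
transported). [cite: MochizukiSemiAnbd2006, Thm 6.8(iv) p.75] [cite: MochizukiGalSect2005, Cor 2.8 p.11]

Proof-only companion (abc-iut cell, layer L3, seat abc-iut-L3-t7; row «Q-IV·TRIPOD-DESCENT»; sub-DAG re-cut of
Thm. 6.8 (iv), statements `TemperedAnabelianThm68ivSub.lean`).  `Thm68Sub.tripodBelyiWitness_transport`: an
isomorphism `α : Π^temp_{X_K} ⥲ Π^temp_{Y_L}` with (hΔ), Thm. 6.5 (iii) for `X ↔ Y` and for the curves underlying
objects, Thm. 6.8 (i) for `Y_L` (coverings + objects hit on the nose + full), T68-B1 (compact decomposition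
groups), T68-B4 (images of cusps) for `Y_L`, and Thm. 6.5 (ii) (commensurable terminality) carries a tripod-Belyi
witness of `x ∈ X̄_K` (`Thm68Sub.TripodBelyiWitness X DXs x`) to a tripod-Belyi witness of a closed point
`y ∈ Ȳ_L` with `α(D_x)` a conjugate of `D_y` — the analogue for (iv) of T68iii-L06 / `exists_transported_witness`.
All inputs are NAMED hypotheses (the typed leaves of the sub-DAG); nothing of [SemiAnbd]/[GalSect] is asserted;
nothing here takes a side on [IUTchIII] Cor. 3.12.
-/

noncomputable section

namespace Literature.AnabelianGeometry.SemiGraphs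

open scoped Pointwise
open CategoryTheory Topology

variable {p : ℕ} [Fact p.Prime]

namespace Thm68Sub

variable {X Y : TemperedCurve p}

/-- **T68iv-L06′ PROVED — transport of tripod-Belyi witnesses along `α`.**  Objects go to on-the-nose
realisations (`S'` to a covering object with no cusp filled, `B`, `T` by «objects hit on the nose»), the four
arrows `ψ, π, ι, g` to realisations of the chosen transported representatives (fullness), clause by clause:
(1) `Δ^temp_Y = α(Δ^temp_X) ≤ α(H_{S'})`; (2) the `H`-inclusion clause through `selfIso ∘ θ = α ∘ selfIso`; (3)
`isTripodObj_transport`; (4)(5) OF-type + surjective (`isOFTypeRep_rep`, `rep_surjective`); (6) injective with open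
image of finite index; (7) the cusp over `x` goes to a cusp of the realised object (Thm. 6.5 (iii)) whose image
under `ψ' ≫ π'` lands openly in some `D_y` (T68-B4), and then `α(D_x) ~ D_y` by compactness + commensurable
terminality (the [GalSect] Cor. 2.5 mechanism, T68-B2); (8) every cusp of the curve of `S''` is exhibited by `ψ'`
(pull back along `θ_{S'}`, Thm. 6.5 (iii) both ways). [cite: MochizukiGalSect2005, Cor 2.8 p.11]
[cite: MochizukiSemiAnbd2006, Thm 6.8(iv) p.75] -/
theorem tripodBelyiWitness_transport (DXs : DLocSchemeData X) (DYs : DLocSchemeData Y)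
    (α : X.PiTemp ≃ₜ* Y.PiTemp)
    (hΔ : X.DeltaTemp.map α.toMulEquiv.toMonoidHom = Y.DeltaTemp)
    (h65 : X.IsoPreservesCuspidalDecomp Y) (h65' : Y.IsoPreservesCuspidalDecomp X)
    (h65iii : ∀ (Z : DXs.DLocK) (Z' : DYs.DLocK),
      (DXs.curve Z).IsoPreservesCuspidalDecomp (DYs.curve Z'))
    (h65iii' : ∀ (Z' : DYs.DLocK) (Z : DXs.DLocK),
      (DYs.curve Z').IsoPreservesCuspidalDecomp (DXs.curve Z))
    (hFullY : PiFunctorFull Y DYs) (hCovY : CoveringObjectOfOpenSubgroup Y DYs)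
    (hNoseY : ObjectsHitOnTheNose Y DYs) (hB4Y : CuspImageOpenInDecomp Y DYs)
    (hcX : DecompCompact X) (hcY : DecompCompact Y)
    (hctX : X.DecompCommensurablyTerminal) (hctY : Y.DecompCommensurablyTerminal)
    {x : X.Pt} (hx : TripodBelyiWitness X DXs x) :
    ∃ y : Y.Pt, TripodBelyiWitness Y DYs y ∧
      ∃ γ' : ConjAct Y.PiTemp, (X.decomp x).map α.toMulEquiv.toMonoidHom = γ' • Y.decomp y := by
  letI := DXs.catK; letI := DYs.catK
  letI := DLocObj.dlocCategory X; letI := DLocObj.dlocCategory Y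
  have hI : ∀ I : Subgroup X.PiTemp, X.IsCuspidalGeometricDecompositionGroup I →
      Y.IsCuspidalGeometricDecompositionGroup (I.map α.toMulEquiv.toMonoidHom) :=
    fun I h => (h65 α I).2 h
  have hI' : ∀ I' : Subgroup Y.PiTemp, Y.IsCuspidalGeometricDecompositionGroup I' →
      X.IsCuspidalGeometricDecompositionGroup (I'.map α.symm.toMulEquiv.toMonoidHom) :=
    fun I h => (h65' α.symm I).2 h
  obtain ⟨B, S', T, ψ, π, ι, g, ⟨hgS, hΔS⟩, ⟨cπ, hπ⟩, hT, ⟨φψ, hφψ, hOFψ, hsψ⟩, ⟨φι, hφι, hOFι, hsι⟩,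
    ⟨φg, hφg, hinj, hog, hfg⟩, ⟨Dz, γ, hDz, hx7⟩, h8⟩ := hx
  -- ### the objects, realised ON THE NOSE
  obtain ⟨B', hHB, hNB⟩ := hNoseY ((DXs.pi1Functor.obj B).transport α hI hΔ)
  obtain ⟨T', hHT, hNT⟩ := hNoseY ((DXs.pi1Functor.obj T).transport α hI hΔ)
  obtain ⟨S'', hHS, hgS''⟩ := hCovY ((DXs.pi1Functor.obj S').transport α hI hΔ).H ((DXs.pi1Functor.obj S').transport α hI hΔ).isOpen_H
    ((DXs.pi1Functor.obj S').transport α hI hΔ).finiteIndex_H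
  have hNS : (DYs.pi1Functor.obj S'').N = ((DXs.pi1Functor.obj S').transport α hI hΔ).N := by
    change _ = (DXs.pi1Functor.obj S').N.map α.toMulEquiv.toMonoidHom
    exact (map_N_eq_of_gens_empty α _ hgS _ hgS'').symm
  have hH0 : (DYs.pi1Functor.obj DYs.self).H = ((DXs.pi1Functor.obj DXs.self).transport α hI hΔ).H := by
    change _ = (DXs.pi1Functor.obj DXs.self).H.map α.toMulEquiv.toMonoidHom
    rw [DXs.pi1Functor_self_H, DYs.pi1Functor_self_H, Subgroup.map_top_of_surjective _ α.surjective]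
  have hN0 : (DYs.pi1Functor.obj DYs.self).N = ((DXs.pi1Functor.obj DXs.self).transport α hI hΔ).N := by
    change _ = (DXs.pi1Functor.obj DXs.self).N.map α.toMulEquiv.toMonoidHom
    exact (map_N_eq_of_gens_empty α _ DXs.pi1Functor_self_gens _ DYs.pi1Functor_self_gens).symm
  -- ### the isomorphisms `θ`
  let θB : (DXs.curve B).PiTemp ≃ₜ* (DYs.curve B').PiTemp :=
    ((DXs.objIso B).symm.trans (DLocObj.jIso α hI hΔ (DXs.pi1Functor.obj B))).trans
      ((jEquivOfEq _ _ hHB hNB).symm.trans (DYs.objIso B'))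
  have hθB : ∀ j, θB (DXs.objIso B j) =
      DYs.objIso B' ((jEquivOfEq _ _ hHB hNB).symm (DLocObj.jIso α hI hΔ (DXs.pi1Functor.obj B) j)) := fun j => by
    change DYs.objIso B' ((jEquivOfEq _ _ hHB hNB).symm (DLocObj.jIso α hI hΔ (DXs.pi1Functor.obj B)
      ((DXs.objIso B).symm (DXs.objIso B j)))) = _
    rw [ContinuousMulEquiv.symm_apply_apply]
  let θS : (DXs.curve S').PiTemp ≃ₜ* (DYs.curve S'').PiTemp :=
    ((DXs.objIso S').symm.trans (DLocObj.jIso α hI hΔ (DXs.pi1Functor.obj S'))).trans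
      ((jEquivOfEq _ _ hHS hNS).symm.trans (DYs.objIso S''))
  have hθS : ∀ j, θS (DXs.objIso S' j) =
      DYs.objIso S'' ((jEquivOfEq _ _ hHS hNS).symm (DLocObj.jIso α hI hΔ (DXs.pi1Functor.obj S') j)) := fun j => by
    change DYs.objIso S'' ((jEquivOfEq _ _ hHS hNS).symm (DLocObj.jIso α hI hΔ (DXs.pi1Functor.obj S')
      ((DXs.objIso S').symm (DXs.objIso S' j)))) = _
    rw [ContinuousMulEquiv.symm_apply_apply]
  let θT : (DXs.curve T).PiTemp ≃ₜ* (DYs.curve T').PiTemp :=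
    ((DXs.objIso T).symm.trans (DLocObj.jIso α hI hΔ (DXs.pi1Functor.obj T))).trans
      ((jEquivOfEq _ _ hHT hNT).symm.trans (DYs.objIso T'))
  have hθT : ∀ j, θT (DXs.objIso T j) =
      DYs.objIso T' ((jEquivOfEq _ _ hHT hNT).symm (DLocObj.jIso α hI hΔ (DXs.pi1Functor.obj T) j)) := fun j => by
    change DYs.objIso T' ((jEquivOfEq _ _ hHT hNT).symm (DLocObj.jIso α hI hΔ (DXs.pi1Functor.obj T)
      ((DXs.objIso T).symm (DXs.objIso T j)))) = _
    rw [ContinuousMulEquiv.symm_apply_apply]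
  let θ0 : (DXs.curve DXs.self).PiTemp ≃ₜ* (DYs.curve DYs.self).PiTemp :=
    ((DXs.objIso DXs.self).symm.trans (DLocObj.jIso α hI hΔ (DXs.pi1Functor.obj DXs.self))).trans
      ((jEquivOfEq _ _ hH0 hN0).symm.trans (DYs.objIso DYs.self))
  have hθ0 : ∀ j, θ0 (DXs.objIso DXs.self j) =
      DYs.objIso DYs.self ((jEquivOfEq _ _ hH0 hN0).symm (DLocObj.jIso α hI hΔ (DXs.pi1Functor.obj DXs.self) j)) := fun j => by
    change DYs.objIso DYs.self ((jEquivOfEq _ _ hH0 hN0).symm (DLocObj.jIso α hI hΔ (DXs.pi1Functor.obj DXs.self)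
      ((DXs.objIso DXs.self).symm (DXs.objIso DXs.self j)))) = _
    rw [ContinuousMulEquiv.symm_apply_apply]
  -- ### representatives compatible with `π₁`, and the realised arrows
  obtain ⟨cψ, hcψ⟩ := exists_conj_rep DXs ψ φψ hφψ
  obtain ⟨cι, hcι⟩ := exists_conj_rep DXs ι φι hφι
  obtain ⟨φπ, hφπ, cπ', hcπ'⟩ := DXs.map_objIso π
  obtain ⟨ρψ, ψ', hρψ, hψ'⟩ := exists_realized DXs DYs α hI hΔ hFullY hHB hNB hHS hNS φψ
  obtain ⟨ρι, ι', hρι, hι'⟩ := exists_realized DXs DYs α hI hΔ hFullY hHS hNS hHT hNT φι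
  obtain ⟨ρg, g', hρg, hg'⟩ := exists_realized DXs DYs α hI hΔ hFullY hHB hNB hHT hNT φg
  obtain ⟨ρπ, π', hρπ, hπ'⟩ := exists_realized DXs DYs α hI hΔ hFullY hHS hNS hH0 hN0 φπ
  obtain ⟨kψ, hkψ⟩ := pi1_realized_conj DXs DYs α hI hΔ hHB hNB hHS hNS θB hθB θS hθS hcψ hρψ hψ'
  obtain ⟨kπ, hkπ⟩ := pi1_realized_conj DXs DYs α hI hΔ hHS hNS hH0 hN0 θS hθS θ0 hθ0 hcπ' hρπ hπ'
  obtain ⟨k1, hk1⟩ := pi1_comp_conj DYs ψ' π'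
  obtain ⟨k4, hk4⟩ := pi1_comp_conj DXs ψ π
  have hk4' : ∀ d, DXs.pi1 π (DXs.pi1 ψ d) = k4⁻¹ * DXs.pi1 (ψ ≫ π) d * k4 := fun d => by
    rw [hk4]; group
  -- ### clause (7): the transported cusp over `x`, the point `y` (T68-B4)
  have hDz' : (DYs.curve B').IsCuspidalDecompositionGroup (Dz.map θB.toMulEquiv.toMonoidHom) :=
    ((h65iii B B') θB Dz).1 hDz
  obtain ⟨y, γy, hrestY⟩ := hB4Y B' (ψ' ≫ π') _ hDz'
  refine ⟨y, ⟨B', S'', T', ψ', π', ι', g', ⟨hgS'', ?_⟩, ?_, ?_, ⟨ρψ, hψ', ?_, ?_⟩, ⟨ρι, hι', ?_, ?_⟩,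
    ⟨ρg, hg', ?_, ?_, ?_⟩, ⟨Dz.map θB.toMulEquiv.toMonoidHom, γy, hDz', hrestY⟩, ?_⟩, ?_⟩
  · -- (1) `Δ^temp_Y ≤ H_{S''} = α(H_{S'})`
    rw [hHS]
    change Y.DeltaTemp ≤ (DXs.pi1Functor.obj S').H.map α.toMulEquiv.toMonoidHom
    rw [← hΔ]
    exact Subgroup.map_mono hΔS
  · -- (2) `π'` induces the inclusion of `H_{S''}` up to inner
    refine ⟨DYs.selfIso kπ * α cπ, fun h' => ?_⟩
    have hm : (h' : Y.PiTemp) ∈ ((DXs.pi1Functor.obj S').transport α hI hΔ).H := hHS ▸ h'.2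
    obtain ⟨h₀, hh₀, hh₀e⟩ := Subgroup.mem_map.1 hm
    have e1 : DYs.objIso S'' ((DYs.pi1Functor.obj S'').proj h') =
        θS (DXs.objIso S' ((DXs.pi1Functor.obj S').proj ⟨h₀, hh₀⟩)) := by
      rw [theta_objIso_proj DXs DYs α hI hΔ S' S'' hHS hNS θS hθS ⟨h₀, hh₀⟩]
      congr 2
      exact Subtype.ext hh₀e.symm
    rw [e1, hkπ, map_mul, map_mul, map_inv, selfIso_theta DXs DYs α hI hΔ hH0 hN0 θ0 hθ0, hπ ⟨h₀, hh₀⟩,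
      map_mul, map_mul, map_inv]
    have : α (h₀ : X.PiTemp) = (h' : Y.PiTemp) := hh₀e
    rw [← this]
    group
  · -- (3) the tripod object
    exact isTripodObj_congr hHT.symm hNT.symm (isTripodObj_transport α hI hI' hΔ _ hT)
  · -- (4) `ψ'` open immersion: OF-type …
    exact isOFTypeRep_rep DXs DYs α hI hΔ hHB hNB hHS hNS hρψ hOFψ
  · -- … and surjective
    exact rep_surjective DXs DYs α hI hΔ hHB hNB hHS hNS hρψ hsψ
  · -- (5) `ι'` open immersion
    exact isOFTypeRep_rep DXs DYs α hI hΔ hHS hNS hHT hNT hρι hOFι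
  · exact rep_surjective DXs DYs α hI hΔ hHS hNS hHT hNT hρι hsι
  · -- (6) `g'` finite étale: injective …
    exact rep_injective DXs DYs α hI hΔ hHB hNB hHT hNT hρg hinj
  · -- … open image …
    exact (rep_range_open_finiteIndex DXs DYs α hI hΔ hHB hNB hHT hNT hρg hog hfg).1
  · -- … of finite index
    exact (rep_range_open_finiteIndex DXs DYs α hI hΔ hHB hNB hHT hNT hρg hog hfg).2
  · -- (8) every cusp of the curve of `S''` is exhibited by `ψ'`
    intro D' hD'
    set DX : Subgroup (DXs.curve S').PiTemp := D'.map θS.symm.toMulEquiv.toMonoidHom with hDX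
    have hDXc : (DXs.curve S').IsCuspidalDecompositionGroup DX := ((h65iii' S'' S') θS.symm D').1 hD'
    obtain ⟨Dz₈, γ₈, hDz₈, hle₈, hop₈⟩ := h8 DX hDXc
    have hEq : DX.map θS.toMulEquiv.toMonoidHom = D' := DLocObj.map_symm_map θS D'
    -- `θ_{S'}(π₁(ψ)(d)) = kψ⁻¹ · π₁(ψ')(θ_B d) · kψ`
    have hkey₈ : (γ₈ • Dz₈.map (DXs.pi1 ψ).toMonoidHom).map θS.toMulEquiv.toMonoidHom =
        ConjAct.toConjAct (θS (ConjAct.ofConjAct γ₈) * kψ⁻¹) •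
          (Dz₈.map θB.toMulEquiv.toMonoidHom).map (DYs.pi1 ψ').toMonoidHom := by
      have h1 : (γ₈ • Dz₈.map (DXs.pi1 ψ).toMonoidHom).map θS.toMulEquiv.toMonoidHom =
          ConjAct.toConjAct (θS (ConjAct.ofConjAct γ₈)) •
            (Dz₈.map (DXs.pi1 ψ).toMonoidHom).map θS.toMulEquiv.toMonoidHom := by
        have := map_smul_eq θS.toMulEquiv.toMonoidHom (ConjAct.ofConjAct γ₈) (Dz₈.map (DXs.pi1 ψ).toMonoidHom)
        rw [ConjAct.toConjAct_ofConjAct] at this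
        exact this
      have h2 : (Dz₈.map (DXs.pi1 ψ).toMonoidHom).map θS.toMulEquiv.toMonoidHom =
          ConjAct.toConjAct kψ⁻¹ • (Dz₈.map θB.toMulEquiv.toMonoidHom).map (DYs.pi1 ψ').toMonoidHom := by
        ext z
        simp only [Subgroup.mem_map, Subgroup.mem_smul_pointwise_iff_exists, ConjAct.smul_def,
          ConjAct.ofConjAct_toConjAct]
        constructor
        · rintro ⟨_, ⟨d, hd, rfl⟩, rfl⟩
          refine ⟨DYs.pi1 ψ' (θB d), ⟨_, ⟨d, hd, rfl⟩, rfl⟩, ?_⟩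
          change kψ⁻¹ * DYs.pi1 ψ' (θB d) * kψ⁻¹⁻¹ = θS (DXs.pi1 ψ d)
          rw [hkψ]; group
        · rintro ⟨_, ⟨_, ⟨d, hd, rfl⟩, rfl⟩, rfl⟩
          refine ⟨DXs.pi1 ψ d, ⟨d, hd, rfl⟩, ?_⟩
          change θS (DXs.pi1 ψ d) = kψ⁻¹ * DYs.pi1 ψ' (θB d) * kψ⁻¹⁻¹
          rw [hkψ]; group
      rw [h1, h2, ← mul_smul, ← map_mul]
    have H1 : (γ₈ • Dz₈.map (DXs.pi1 ψ).toMonoidHom).map θS.toMulEquiv.toMonoidHom ≤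
        DX.map θS.toMulEquiv.toMonoidHom := Subgroup.map_mono hle₈
    have H2 := isOpen_subgroupOf_map θS hop₈
    rw [hEq] at H1 H2
    rw [hkey₈] at H1 H2
    exact ⟨Dz₈.map θB.toMulEquiv.toMonoidHom, ConjAct.toConjAct (θS (ConjAct.ofConjAct γ₈) * kψ⁻¹),
      ((h65iii B B') θB Dz₈).1 hDz₈, H1, H2⟩
  · -- ### `α(D_x)` is a conjugate of `D_y` (the [GalSect] Cor. 2.5 mechanism)
    -- elementwise description of `π₁(ψ' ≫ π')` on the transported cusp group
    set KK : Y.PiTemp := DYs.selfIso k1 * DYs.selfIso (DYs.pi1 π' kψ) * DYs.selfIso kπ *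
      (α (DXs.selfIso k4))⁻¹ with hKK
    have hY : ∀ d : (DXs.curve B).PiTemp, DYs.selfIso (DYs.pi1 (ψ' ≫ π') (θB d)) =
        KK * α (DXs.selfIso (DXs.pi1 (ψ ≫ π) d)) * KK⁻¹ := by
      intro d
      have e1 : DYs.pi1 (ψ' ≫ π') (θB d) = k1 * DYs.pi1 π' (DYs.pi1 ψ' (θB d)) * k1⁻¹ := hk1 _
      have e2 : DYs.pi1 π' (DYs.pi1 ψ' (θB d)) =
          DYs.pi1 π' kψ * DYs.pi1 π' (θS (DXs.pi1 ψ d)) * (DYs.pi1 π' kψ)⁻¹ := by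
        rw [hkψ, map_mul, map_mul, map_inv]
      have e3 : DYs.pi1 π' (θS (DXs.pi1 ψ d)) = kπ * θ0 (DXs.pi1 π (DXs.pi1 ψ d)) * kπ⁻¹ := hkπ _
      have e4 : DYs.selfIso (θ0 (DXs.pi1 π (DXs.pi1 ψ d))) = α (DXs.selfIso (DXs.pi1 π (DXs.pi1 ψ d))) :=
        selfIso_theta DXs DYs α hI hΔ hH0 hN0 θ0 hθ0 _
      rw [e1, e2, e3]
      simp only [map_mul, map_inv]
      rw [e4, hk4' d]
      simp only [map_mul, map_inv]
      rw [hKK]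
      group
    -- the two open subgroups and the comparison isomorphism `F = Inn(κ) ∘ α`
    set UX : Subgroup X.PiTemp :=
      γ • (Dz.map (DXs.pi1 (ψ ≫ π)).toMonoidHom).map DXs.selfIso.toMulEquiv.toMonoidHom with hUX
    set UY : Subgroup Y.PiTemp := γy • ((Dz.map θB.toMulEquiv.toMonoidHom).map
      (DYs.pi1 (ψ' ≫ π')).toMonoidHom).map DYs.selfIso.toMulEquiv.toMonoidHom with hUY
    have hleX : UX ≤ X.decomp x := hx7.1
    have hopenX : IsOpen ((UX.subgroupOf (X.decomp x) : Subgroup (X.decomp x)) : Set (X.decomp x)) := hx7.2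
    have hleY : UY ≤ Y.decomp y := hrestY.1
    have hopenY : IsOpen ((UY.subgroupOf (Y.decomp y) : Subgroup (Y.decomp y)) : Set (Y.decomp y)) :=
      hrestY.2
    set uX : X.PiTemp := ConjAct.ofConjAct γ with huX
    set uY : Y.PiTemp := ConjAct.ofConjAct γy * KK with huY
    set κ : Y.PiTemp := uY * (α uX)⁻¹ with hκ
    let F : X.PiTemp ≃ₜ* Y.PiTemp := α.trans (conjCME κ)
    have hF : ∀ z, F z = κ * α z * κ⁻¹ := fun z => rfl
    have hkey : UX.map F.toMulEquiv.toMonoidHom = UY := by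
      ext z
      constructor
      · rintro ⟨w, hw, rfl⟩
        obtain ⟨w₀, hw₀, rfl⟩ := (Subgroup.mem_smul_pointwise_iff_exists _ _ _).1 hw
        obtain ⟨_, ⟨d, hd, rfl⟩, rfl⟩ := hw₀
        refine (Subgroup.mem_smul_pointwise_iff_exists _ _ _).2
          ⟨DYs.selfIso (DYs.pi1 (ψ' ≫ π') (θB d)), ⟨_, ⟨_, ⟨d, hd, rfl⟩, rfl⟩, rfl⟩, ?_⟩
        change ConjAct.ofConjAct γy * DYs.selfIso (DYs.pi1 (ψ' ≫ π') (θB d)) * (ConjAct.ofConjAct γy)⁻¹ =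
          F (ConjAct.ofConjAct γ * DXs.selfIso (DXs.pi1 (ψ ≫ π) d) * (ConjAct.ofConjAct γ)⁻¹)
        rw [hF, hY d, hκ, huY, huX]
        simp only [map_mul, map_inv]
        group
      · intro hz
        obtain ⟨w, hw, rfl⟩ := (Subgroup.mem_smul_pointwise_iff_exists _ _ _).1 hz
        obtain ⟨_, ⟨_, ⟨d, hd, rfl⟩, rfl⟩, rfl⟩ := hw
        refine ⟨ConjAct.ofConjAct γ * DXs.selfIso (DXs.pi1 (ψ ≫ π) d) * (ConjAct.ofConjAct γ)⁻¹, ?_, ?_⟩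
        · exact (Subgroup.mem_smul_pointwise_iff_exists _ _ _).2
            ⟨DXs.selfIso (DXs.pi1 (ψ ≫ π) d), ⟨_, ⟨d, hd, rfl⟩, rfl⟩, rfl⟩
        · change F _ = ConjAct.ofConjAct γy * DYs.selfIso (DYs.pi1 (ψ' ≫ π') (θB d)) *
            (ConjAct.ofConjAct γy)⁻¹
          rw [hF, hY d, hκ, huY, huX]
          simp only [map_mul, map_inv]
          group
    -- finite index in `F(D_x)` and in `D_y` (compactness), commensurable terminality of both
    have hleF : UY ≤ (X.decomp x).map F.toMulEquiv.toMonoidHom := hkey ▸ Subgroup.map_mono hleX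
    have hfiF : (UY.subgroupOf ((X.decomp x).map F.toMulEquiv.toMonoidHom)).FiniteIndex := by
      rw [← hkey]
      exact finiteIndex_subgroupOf_of_isOpen (isCompact_map F (hcX x)) (isOpen_subgroupOf_map F hopenX)
    have hfiY : (UY.subgroupOf (Y.decomp y)).FiniteIndex :=
      finiteIndex_subgroupOf_of_isOpen (hcY y) hopenY
    have hctF : Subgroup.Commensurable.commensurator ((X.decomp x).map F.toMulEquiv.toMonoidHom) =
        (X.decomp x).map F.toMulEquiv.toMonoidHom := commensurator_map_eq F.toMulEquiv (hctX x)
    have h1 : (X.decomp x).map F.toMulEquiv.toMonoidHom ≤ Y.decomp y :=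
      le_of_finiteIndex_le_of_commensurator_eq hleF hfiF hleY hfiY (hctY y)
    have h2 : Y.decomp y ≤ (X.decomp x).map F.toMulEquiv.toMonoidHom :=
      le_of_finiteIndex_le_of_commensurator_eq hleY hfiY hleF hfiF hctF
    have hEq : (X.decomp x).map F.toMulEquiv.toMonoidHom = Y.decomp y := le_antisymm h1 h2
    have hFmap : (X.decomp x).map F.toMulEquiv.toMonoidHom =
        ConjAct.toConjAct κ • (X.decomp x).map α.toMulEquiv.toMonoidHom := by
      rw [← map_conjCME, Subgroup.map_map]
      rfl
    refine ⟨(ConjAct.toConjAct κ)⁻¹, ?_⟩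
    rw [← hEq, hFmap, inv_smul_smul]

end Thm68Sub

end Literature.AnabelianGeometry.SemiGraphs

end
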